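import Mathlib.Tactic.Ring
import Mathlib.Tactic.Linarith
import Mathlib.Tactic.Positivity
import Mathlib.Tactic.LinearCombination
import Mathlib.Data.Real.Basic
import Summits.HodgeConjecture.HodgeConjecture.Theorems.WeilClassTestFormatFiveThreeProductFormula
import HarnessLib

/-!
# Conjecture N (hodge-weil ladder, GAPS G51b), format (5,3), real charges: THE LOW-PAIR / HIGH-PAIR CLASSES, EVERY λ ≤ 1

Prover 2, generation 17 (note `run/shared/lean/b2b/hodge-weil/b2b-hweil-pv2-g17/REAL-N53-G17.md`). Setting of `CONJECTURE-N.md` §1 in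
format (5,3), real charges, centred coordinates: E-roots `(A_e, u_e)`, F-roots `(B_g, v_g)`, purity sums `P1, P2, P4`, pairwise ampleness
`|u_e − v_g| ≤ A_e − B_g`, `Q₂ = ½S_AS_u + S_{Au}² − 3S_{A²u²}`, `Q₄ = 3S_{u⁴} − (3/2)S_u²`, `G_λ = Q₂ + λQ₄`; real Conjecture N is `G₁ ≥ 0`.
pv2-g15's divided-difference product formula (`WeilClassTestFormatFiveThreeProductFormula.Glam_eq_dd12`) writes, on the pure locus,
`G_λ = 2·Σ_e T_e` with FIVE Leibniz terms `T_e = Σ_{{i,j}⊔{k,l} = E∖e} a_ia_j·b_kb_l − 6λ·∏_{E∖e} b`, where the root data `(a_i, b_i) =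
(A_i − B_g, u_i − v_g)` are taken with respect to `F₁` for the E-roots listed BEFORE the pivot `e` and with respect to `F₂` for those AFTER it.
OBSERVATION (this file): for `λ ≤ 1` a term whose four charge differences `b` have one sign is `≥ 0`, because
`Σ a_ia_j b_kb_l − 6λ∏b = Σ_{pairs} [(a_i − b_i)a_j + b_i(a_j − b_j)]·b_kb_l + 6(1 − λ)∏b` (`bracket4_nonneg`, `bracket4_nonpos`; only
`|b| ≤ a` is used). Hence (`Glam_nonneg_lowPair`): if `F₁` is weakly below `E₁, E₂, E₃, E₄` in charge and `F₂` is weakly below `E₂, E₃, E₄, E₅`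
(labels otherwise arbitrary; `F₃` unconstrained), then `Q₂ + λQ₄ ≥ 0` for every `λ ≤ 1` — with sorted charges these are the patterns
`(n₁, n₂, n₃)` with `n₁ = 0, n₂ ≤ 1` (numbers of E-charges below the three F-charges), in particular the patterns `(0,0,3), (0,0,4), (0,1,3)`
that were open on the `Q₄ < 0` half; and the mirror (`Glam_nonneg_highPair`): `F₃` weakly above `E₂..E₅` and `F₂` weakly above `E₁..E₄`
(patterns `n₂ ≥ 4, n₃ = 5`). The constant `λ = 1` is the natural boundary of the termwise method (`a_ia_j − λb_ib_j ≥ 0`); the class (0,5) needed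
`λ = 4/3` machinery (pv2-g16) precisely because no pair of F-roots sees `E` minus a pivot one-sidedly there.
Pure algebra; nothing here is a case of HC, a rung or a door edge; no statement of Markman's papers is used. New cell result ⇒ Summits/.
-/

set_option linter.dupNamespace false

open Summit.HodgeConjecture.HodgeConjecture.WeilClassTestFormatFiveThreeProductFormula

namespace Summit.HodgeConjecture.HodgeConjecture.WeilClassTestFormatFiveThreeLowPair

/-- THE ONE-SIGNED LEIBNIZ TERM, nonnegative charge differences: if `0 ≤ b_i ≤ a_i` (i = 1..4) and `λ ≤ 1` then
`Σ_{{i,j}} a_ia_j b_kb_l − 6λ·b₁b₂b₃b₄ ≥ 0` (the sum over the six splittings `{i,j} ⊔ {k,l}` of the four indices, written in the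
order of `Glam_eq_dd12`). Proof: `= Σ [(a_i − b_i)a_j + b_i(a_j − b_j)] b_kb_l + 6(1 − λ)∏b`, a sum of products of nonnegative reals. -/
theorem bracket4_nonneg (a₁ a₂ a₃ a₄ b₁ b₂ b₃ b₄ l : ℝ)
    (hb₁ : 0 ≤ b₁) (hb₂ : 0 ≤ b₂) (hb₃ : 0 ≤ b₃) (hb₄ : 0 ≤ b₄)
    (h₁ : b₁ ≤ a₁) (h₂ : b₂ ≤ a₂) (h₃ : b₃ ≤ a₃) (h₄ : b₄ ≤ a₄) (hl : l ≤ 1) :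
    0 ≤ (a₁ * a₂ * b₃ * b₄ + a₁ * b₂ * a₃ * b₄ + a₁ * b₂ * b₃ * a₄ + b₁ * a₂ * a₃ * b₄ + b₁ * a₂ * b₃ * a₄ + b₁ * b₂ * a₃ * a₄) - 6 * l * (b₁ * b₂ * b₃ * b₄) := by
  have ha₁ : 0 ≤ a₁ := hb₁.trans h₁
  have ha₂ : 0 ≤ a₂ := hb₂.trans h₂
  have ha₃ : 0 ≤ a₃ := hb₃.trans h₃
  have ha₄ : 0 ≤ a₄ := hb₄.trans h₄
  have d₁ : 0 ≤ a₁ - b₁ := sub_nonneg.mpr h₁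
  have d₂ : 0 ≤ a₂ - b₂ := sub_nonneg.mpr h₂
  have d₃ : 0 ≤ a₃ - b₃ := sub_nonneg.mpr h₃
  have d₄ : 0 ≤ a₄ - b₄ := sub_nonneg.mpr h₄
  have dl : 0 ≤ 1 - l := sub_nonneg.mpr hl
  have key : (a₁ * a₂ * b₃ * b₄ + a₁ * b₂ * a₃ * b₄ + a₁ * b₂ * b₃ * a₄ + b₁ * a₂ * a₃ * b₄ + b₁ * a₂ * b₃ * a₄ + b₁ * b₂ * a₃ * a₄) - 6 * l * (b₁ * b₂ * b₃ * b₄)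
      = (a₁ - b₁) * a₂ * b₃ * b₄ + b₁ * (a₂ - b₂) * b₃ * b₄ + (a₁ - b₁) * a₃ * b₂ * b₄ + b₁ * (a₃ - b₃) * b₂ * b₄ + (a₁ - b₁) * a₄ * b₂ * b₃ + b₁ * (a₄ - b₄) * b₂ * b₃ + (a₂ - b₂) * a₃ * b₁ * b₄ + b₂ * (a₃ - b₃) * b₁ * b₄ + (a₂ - b₂) * a₄ * b₁ * b₃ + b₂ * (a₄ - b₄) * b₁ * b₃ + (a₃ - b₃) * a₄ * b₁ * b₂ + b₃ * (a₄ - b₄) * b₁ * b₂ + 6 * (1 - l) * (b₁ * b₂ * b₃ * b₄) := by ring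
  rw [key]
  positivity

/-- THE ONE-SIGNED LEIBNIZ TERM, nonpositive charge differences: if `−a_i ≤ b_i ≤ 0` (i = 1..4) and `λ ≤ 1` then the same
polynomial is `≥ 0` (it is even in `b`; apply `bracket4_nonneg` to `−b`). -/
theorem bracket4_nonpos (a₁ a₂ a₃ a₄ b₁ b₂ b₃ b₄ l : ℝ)
    (hb₁ : b₁ ≤ 0) (hb₂ : b₂ ≤ 0) (hb₃ : b₃ ≤ 0) (hb₄ : b₄ ≤ 0)
    (h₁ : -a₁ ≤ b₁) (h₂ : -a₂ ≤ b₂) (h₃ : -a₃ ≤ b₃) (h₄ : -a₄ ≤ b₄) (hl : l ≤ 1) :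
    0 ≤ (a₁ * a₂ * b₃ * b₄ + a₁ * b₂ * a₃ * b₄ + a₁ * b₂ * b₃ * a₄ + b₁ * a₂ * a₃ * b₄ + b₁ * a₂ * b₃ * a₄ + b₁ * b₂ * a₃ * a₄) - 6 * l * (b₁ * b₂ * b₃ * b₄) := by
  have h := bracket4_nonneg a₁ a₂ a₃ a₄ (-b₁) (-b₂) (-b₃) (-b₄) l (by linarith) (by linarith) (by linarith) (by linarith)
    (by linarith) (by linarith) (by linarith) (by linarith) hl
  calc (0:ℝ) ≤ (a₁ * a₂ * (-b₃) * (-b₄) + a₁ * (-b₂) * a₃ * (-b₄) + a₁ * (-b₂) * (-b₃) * a₄ + (-b₁) * a₂ * a₃ * (-b₄) + (-b₁) * a₂ * (-b₃) * a₄ + (-b₁) * (-b₂) * a₃ * a₄) - 6 * l * ((-b₁) * (-b₂) * (-b₃) * (-b₄)) := h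
    _ = (a₁ * a₂ * b₃ * b₄ + a₁ * b₂ * a₃ * b₄ + a₁ * b₂ * b₃ * a₄ + b₁ * a₂ * a₃ * b₄ + b₁ * a₂ * b₃ * a₄ + b₁ * b₂ * a₃ * a₄) - 6 * l * (b₁ * b₂ * b₃ * b₄) := by ring

/-- REAL CONJECTURE N (every `λ ≤ 1`) ON THE LOW-PAIR CLASS of format (5,3): a centred, pure (P1, P2, P4) configuration in which
`F₁` is weakly below `E₁, E₂, E₃, E₄` in charge (`v₁ ≤ u_e`) and `F₂` is weakly below `E₂, E₃, E₄, E₅` (`v₂ ≤ u_e`), these eight pairs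
being ample (`|u_e − v_g| ≤ A_e − B_g`), satisfies `Q₂ + λ·Q₄ ≥ 0`. (No hypothesis on `F₃`, on `E₅` versus `F₁`, on `E₁` versus `F₂`, or on
the order of the charges; with sorted charges this is every pattern `(n₁,n₂,n₃)` with `n₁ = 0`, `n₂ ≤ 1`.) Proof: `Glam_eq_dd12` and
`bracket4_nonneg` for each of the five Leibniz terms (pivot order `E₁, …, E₅`). -/
theorem Glam_nonneg_lowPair (A₁ A₂ A₃ A₄ A₅ B₁ B₂ B₃ u₁ u₂ u₃ u₄ u₅ v₁ v₂ v₃ : ℝ)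
    (hA : A₁ + A₂ + A₃ + A₄ + A₅ = B₁ + B₂ + B₃) (hC : u₁ + u₂ + u₃ + u₄ + u₅ = v₁ + v₂ + v₃)
    (hP1 : (A₁ ^ 2 * u₁ + A₂ ^ 2 * u₂ + A₃ ^ 2 * u₃ + A₄ ^ 2 * u₄ + A₅ ^ 2 * u₅) - (B₁ ^ 2 * v₁ + B₂ ^ 2 * v₂ + B₃ ^ 2 * v₃) = 0)
    (hP2 : (A₁ * u₁ ^ 2 + A₂ * u₂ ^ 2 + A₃ * u₃ ^ 2 + A₄ * u₄ ^ 2 + A₅ * u₅ ^ 2) - (B₁ * v₁ ^ 2 + B₂ * v₂ ^ 2 + B₃ * v₃ ^ 2) = 0)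
    (hP4 : (u₁ ^ 3 + u₂ ^ 3 + u₃ ^ 3 + u₄ ^ 3 + u₅ ^ 3) - (v₁ ^ 3 + v₂ ^ 3 + v₃ ^ 3) = 0)
    (p₁₁ : v₁ ≤ u₁) (p₂₁ : v₁ ≤ u₂) (p₃₁ : v₁ ≤ u₃) (p₄₁ : v₁ ≤ u₄)
    (p₂₂ : v₂ ≤ u₂) (p₃₂ : v₂ ≤ u₃) (p₄₂ : v₂ ≤ u₄) (p₅₂ : v₂ ≤ u₅)
    (m₁₁ : |u₁ - v₁| ≤ A₁ - B₁) (m₂₁ : |u₂ - v₁| ≤ A₂ - B₁) (m₃₁ : |u₃ - v₁| ≤ A₃ - B₁) (m₄₁ : |u₄ - v₁| ≤ A₄ - B₁)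
    (m₂₂ : |u₂ - v₂| ≤ A₂ - B₂) (m₃₂ : |u₃ - v₂| ≤ A₃ - B₂) (m₄₂ : |u₄ - v₂| ≤ A₄ - B₂) (m₅₂ : |u₅ - v₂| ≤ A₅ - B₂)
    (l : ℝ) (hl : l ≤ 1) :
    0 ≤ (1 / 2) * ((A₁ ^ 2 + A₂ ^ 2 + A₃ ^ 2 + A₄ ^ 2 + A₅ ^ 2) - (B₁ ^ 2 + B₂ ^ 2 + B₃ ^ 2)) * ((u₁ ^ 2 + u₂ ^ 2 + u₃ ^ 2 + u₄ ^ 2 + u₅ ^ 2) - (v₁ ^ 2 + v₂ ^ 2 + v₃ ^ 2))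
        + ((A₁ * u₁ + A₂ * u₂ + A₃ * u₃ + A₄ * u₄ + A₅ * u₅) - (B₁ * v₁ + B₂ * v₂ + B₃ * v₃)) ^ 2
        - 3 * ((A₁ ^ 2 * u₁ ^ 2 + A₂ ^ 2 * u₂ ^ 2 + A₃ ^ 2 * u₃ ^ 2 + A₄ ^ 2 * u₄ ^ 2 + A₅ ^ 2 * u₅ ^ 2) - (B₁ ^ 2 * v₁ ^ 2 + B₂ ^ 2 * v₂ ^ 2 + B₃ ^ 2 * v₃ ^ 2))
      + l * (3 * ((u₁ ^ 4 + u₂ ^ 4 + u₃ ^ 4 + u₄ ^ 4 + u₅ ^ 4) - (v₁ ^ 4 + v₂ ^ 4 + v₃ ^ 4)) - (3 / 2) * ((u₁ ^ 2 + u₂ ^ 2 + u₃ ^ 2 + u₄ ^ 2 + u₅ ^ 2) - (v₁ ^ 2 + v₂ ^ 2 + v₃ ^ 2)) ^ 2) := by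
  have t₁ := bracket4_nonneg (A₂ - B₂) (A₃ - B₂) (A₄ - B₂) (A₅ - B₂) (u₂ - v₂) (u₃ - v₂) (u₄ - v₂) (u₅ - v₂) l
    (sub_nonneg.mpr p₂₂) (sub_nonneg.mpr p₃₂) (sub_nonneg.mpr p₄₂) (sub_nonneg.mpr p₅₂)
    (le_of_abs_le m₂₂) (le_of_abs_le m₃₂) (le_of_abs_le m₄₂) (le_of_abs_le m₅₂) hl
  have t₂ := bracket4_nonneg (A₁ - B₁) (A₃ - B₂) (A₄ - B₂) (A₅ - B₂) (u₁ - v₁) (u₃ - v₂) (u₄ - v₂) (u₅ - v₂) l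
    (sub_nonneg.mpr p₁₁) (sub_nonneg.mpr p₃₂) (sub_nonneg.mpr p₄₂) (sub_nonneg.mpr p₅₂)
    (le_of_abs_le m₁₁) (le_of_abs_le m₃₂) (le_of_abs_le m₄₂) (le_of_abs_le m₅₂) hl
  have t₃ := bracket4_nonneg (A₁ - B₁) (A₂ - B₁) (A₄ - B₂) (A₅ - B₂) (u₁ - v₁) (u₂ - v₁) (u₄ - v₂) (u₅ - v₂) l
    (sub_nonneg.mpr p₁₁) (sub_nonneg.mpr p₂₁) (sub_nonneg.mpr p₄₂) (sub_nonneg.mpr p₅₂)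
    (le_of_abs_le m₁₁) (le_of_abs_le m₂₁) (le_of_abs_le m₄₂) (le_of_abs_le m₅₂) hl
  have t₄ := bracket4_nonneg (A₁ - B₁) (A₂ - B₁) (A₃ - B₁) (A₅ - B₂) (u₁ - v₁) (u₂ - v₁) (u₃ - v₁) (u₅ - v₂) l
    (sub_nonneg.mpr p₁₁) (sub_nonneg.mpr p₂₁) (sub_nonneg.mpr p₃₁) (sub_nonneg.mpr p₅₂)
    (le_of_abs_le m₁₁) (le_of_abs_le m₂₁) (le_of_abs_le m₃₁) (le_of_abs_le m₅₂) hl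
  have t₅ := bracket4_nonneg (A₁ - B₁) (A₂ - B₁) (A₃ - B₁) (A₄ - B₁) (u₁ - v₁) (u₂ - v₁) (u₃ - v₁) (u₄ - v₁) l
    (sub_nonneg.mpr p₁₁) (sub_nonneg.mpr p₂₁) (sub_nonneg.mpr p₃₁) (sub_nonneg.mpr p₄₁)
    (le_of_abs_le m₁₁) (le_of_abs_le m₂₁) (le_of_abs_le m₃₁) (le_of_abs_le m₄₁) hl
  rw [Glam_eq_dd12 A₁ A₂ A₃ A₄ A₅ B₁ B₂ B₃ u₁ u₂ u₃ u₄ u₅ v₁ v₂ v₃ hA hC hP1 hP2 hP4 l]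
  linarith [t₁, t₂, t₃, t₄, t₅]

/-- REAL CONJECTURE N (every `λ ≤ 1`) ON THE HIGH-PAIR CLASS of format (5,3) (mirror of `Glam_nonneg_lowPair`): a centred, pure
configuration in which `F₃` is weakly above `E₂, E₃, E₄, E₅` in charge and `F₂` is weakly above `E₁, E₂, E₃, E₄`, these eight pairs being
ample, satisfies `Q₂ + λ·Q₄ ≥ 0` (sorted patterns `(n₁,n₂,n₃)` with `n₃ = 5`, `n₂ ≥ 4`). Proof: `Glam_eq_dd12` for the relabelled configuration
(pivot order `E₅, …, E₁`, roots `F₃` before / `F₂` after the pivot) and `bracket4_nonpos`. -/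
theorem Glam_nonneg_highPair (A₁ A₂ A₃ A₄ A₅ B₁ B₂ B₃ u₁ u₂ u₃ u₄ u₅ v₁ v₂ v₃ : ℝ)
    (hA : A₁ + A₂ + A₃ + A₄ + A₅ = B₁ + B₂ + B₃) (hC : u₁ + u₂ + u₃ + u₄ + u₅ = v₁ + v₂ + v₃)
    (hP1 : (A₁ ^ 2 * u₁ + A₂ ^ 2 * u₂ + A₃ ^ 2 * u₃ + A₄ ^ 2 * u₄ + A₅ ^ 2 * u₅) - (B₁ ^ 2 * v₁ + B₂ ^ 2 * v₂ + B₃ ^ 2 * v₃) = 0)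
    (hP2 : (A₁ * u₁ ^ 2 + A₂ * u₂ ^ 2 + A₃ * u₃ ^ 2 + A₄ * u₄ ^ 2 + A₅ * u₅ ^ 2) - (B₁ * v₁ ^ 2 + B₂ * v₂ ^ 2 + B₃ * v₃ ^ 2) = 0)
    (hP4 : (u₁ ^ 3 + u₂ ^ 3 + u₃ ^ 3 + u₄ ^ 3 + u₅ ^ 3) - (v₁ ^ 3 + v₂ ^ 3 + v₃ ^ 3) = 0)
    (q₂₃ : u₂ ≤ v₃) (q₃₃ : u₃ ≤ v₃) (q₄₃ : u₄ ≤ v₃) (q₅₃ : u₅ ≤ v₃)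
    (q₁₂ : u₁ ≤ v₂) (q₂₂ : u₂ ≤ v₂) (q₃₂ : u₃ ≤ v₂) (q₄₂ : u₄ ≤ v₂)
    (m₂₃ : |u₂ - v₃| ≤ A₂ - B₃) (m₃₃ : |u₃ - v₃| ≤ A₃ - B₃) (m₄₃ : |u₄ - v₃| ≤ A₄ - B₃) (m₅₃ : |u₅ - v₃| ≤ A₅ - B₃)
    (m₁₂ : |u₁ - v₂| ≤ A₁ - B₂) (m₂₂ : |u₂ - v₂| ≤ A₂ - B₂) (m₃₂ : |u₃ - v₂| ≤ A₃ - B₂) (m₄₂ : |u₄ - v₂| ≤ A₄ - B₂)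
    (l : ℝ) (hl : l ≤ 1) :
    0 ≤ (1 / 2) * ((A₁ ^ 2 + A₂ ^ 2 + A₃ ^ 2 + A₄ ^ 2 + A₅ ^ 2) - (B₁ ^ 2 + B₂ ^ 2 + B₃ ^ 2)) * ((u₁ ^ 2 + u₂ ^ 2 + u₃ ^ 2 + u₄ ^ 2 + u₅ ^ 2) - (v₁ ^ 2 + v₂ ^ 2 + v₃ ^ 2))
        + ((A₁ * u₁ + A₂ * u₂ + A₃ * u₃ + A₄ * u₄ + A₅ * u₅) - (B₁ * v₁ + B₂ * v₂ + B₃ * v₃)) ^ 2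
        - 3 * ((A₁ ^ 2 * u₁ ^ 2 + A₂ ^ 2 * u₂ ^ 2 + A₃ ^ 2 * u₃ ^ 2 + A₄ ^ 2 * u₄ ^ 2 + A₅ ^ 2 * u₅ ^ 2) - (B₁ ^ 2 * v₁ ^ 2 + B₂ ^ 2 * v₂ ^ 2 + B₃ ^ 2 * v₃ ^ 2))
      + l * (3 * ((u₁ ^ 4 + u₂ ^ 4 + u₃ ^ 4 + u₄ ^ 4 + u₅ ^ 4) - (v₁ ^ 4 + v₂ ^ 4 + v₃ ^ 4)) - (3 / 2) * ((u₁ ^ 2 + u₂ ^ 2 + u₃ ^ 2 + u₄ ^ 2 + u₅ ^ 2) - (v₁ ^ 2 + v₂ ^ 2 + v₃ ^ 2)) ^ 2) := by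
  have t₅ := bracket4_nonpos (A₄ - B₂) (A₃ - B₂) (A₂ - B₂) (A₁ - B₂) (u₄ - v₂) (u₃ - v₂) (u₂ - v₂) (u₁ - v₂) l
    (sub_nonpos.mpr q₄₂) (sub_nonpos.mpr q₃₂) (sub_nonpos.mpr q₂₂) (sub_nonpos.mpr q₁₂)
    (neg_le_of_abs_le m₄₂) (neg_le_of_abs_le m₃₂) (neg_le_of_abs_le m₂₂) (neg_le_of_abs_le m₁₂) hl
  have t₄ := bracket4_nonpos (A₅ - B₃) (A₃ - B₂) (A₂ - B₂) (A₁ - B₂) (u₅ - v₃) (u₃ - v₂) (u₂ - v₂) (u₁ - v₂) l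
    (sub_nonpos.mpr q₅₃) (sub_nonpos.mpr q₃₂) (sub_nonpos.mpr q₂₂) (sub_nonpos.mpr q₁₂)
    (neg_le_of_abs_le m₅₃) (neg_le_of_abs_le m₃₂) (neg_le_of_abs_le m₂₂) (neg_le_of_abs_le m₁₂) hl
  have t₃ := bracket4_nonpos (A₅ - B₃) (A₄ - B₃) (A₂ - B₂) (A₁ - B₂) (u₅ - v₃) (u₄ - v₃) (u₂ - v₂) (u₁ - v₂) l
    (sub_nonpos.mpr q₅₃) (sub_nonpos.mpr q₄₃) (sub_nonpos.mpr q₂₂) (sub_nonpos.mpr q₁₂)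
    (neg_le_of_abs_le m₅₃) (neg_le_of_abs_le m₄₃) (neg_le_of_abs_le m₂₂) (neg_le_of_abs_le m₁₂) hl
  have t₂ := bracket4_nonpos (A₅ - B₃) (A₄ - B₃) (A₃ - B₃) (A₁ - B₂) (u₅ - v₃) (u₄ - v₃) (u₃ - v₃) (u₁ - v₂) l
    (sub_nonpos.mpr q₅₃) (sub_nonpos.mpr q₄₃) (sub_nonpos.mpr q₃₃) (sub_nonpos.mpr q₁₂)
    (neg_le_of_abs_le m₅₃) (neg_le_of_abs_le m₄₃) (neg_le_of_abs_le m₃₃) (neg_le_of_abs_le m₁₂) hl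
  have t₁ := bracket4_nonpos (A₅ - B₃) (A₄ - B₃) (A₃ - B₃) (A₂ - B₃) (u₅ - v₃) (u₄ - v₃) (u₃ - v₃) (u₂ - v₃) l
    (sub_nonpos.mpr q₅₃) (sub_nonpos.mpr q₄₃) (sub_nonpos.mpr q₃₃) (sub_nonpos.mpr q₂₃)
    (neg_le_of_abs_le m₅₃) (neg_le_of_abs_le m₄₃) (neg_le_of_abs_le m₃₃) (neg_le_of_abs_le m₂₃) hl
  have key := Glam_eq_dd12 A₅ A₄ A₃ A₂ A₁ B₃ B₂ B₁ u₅ u₄ u₃ u₂ u₁ v₃ v₂ v₁ (by linarith only [hA]) (by linarith only [hC])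
    (by linear_combination hP1) (by linear_combination hP2) (by linear_combination hP4) l
  have key' : (1 / 2) * ((A₁ ^ 2 + A₂ ^ 2 + A₃ ^ 2 + A₄ ^ 2 + A₅ ^ 2) - (B₁ ^ 2 + B₂ ^ 2 + B₃ ^ 2)) * ((u₁ ^ 2 + u₂ ^ 2 + u₃ ^ 2 + u₄ ^ 2 + u₅ ^ 2) - (v₁ ^ 2 + v₂ ^ 2 + v₃ ^ 2))
        + ((A₁ * u₁ + A₂ * u₂ + A₃ * u₃ + A₄ * u₄ + A₅ * u₅) - (B₁ * v₁ + B₂ * v₂ + B₃ * v₃)) ^ 2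
        - 3 * ((A₁ ^ 2 * u₁ ^ 2 + A₂ ^ 2 * u₂ ^ 2 + A₃ ^ 2 * u₃ ^ 2 + A₄ ^ 2 * u₄ ^ 2 + A₅ ^ 2 * u₅ ^ 2) - (B₁ ^ 2 * v₁ ^ 2 + B₂ ^ 2 * v₂ ^ 2 + B₃ ^ 2 * v₃ ^ 2))
      + l * (3 * ((u₁ ^ 4 + u₂ ^ 4 + u₃ ^ 4 + u₄ ^ 4 + u₅ ^ 4) - (v₁ ^ 4 + v₂ ^ 4 + v₃ ^ 4)) - (3 / 2) * ((u₁ ^ 2 + u₂ ^ 2 + u₃ ^ 2 + u₄ ^ 2 + u₅ ^ 2) - (v₁ ^ 2 + v₂ ^ 2 + v₃ ^ 2)) ^ 2)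
      = 2 * (((A₄ - B₂) * (A₃ - B₂) * (u₂ - v₂) * (u₁ - v₂)
          + (A₄ - B₂) * (u₃ - v₂) * (A₂ - B₂) * (u₁ - v₂)
          + (A₄ - B₂) * (u₃ - v₂) * (u₂ - v₂) * (A₁ - B₂)
          + (u₄ - v₂) * (A₃ - B₂) * (A₂ - B₂) * (u₁ - v₂)
          + (u₄ - v₂) * (A₃ - B₂) * (u₂ - v₂) * (A₁ - B₂)
          + (u₄ - v₂) * (u₃ - v₂) * (A₂ - B₂) * (A₁ - B₂)
          + (A₅ - B₃) * (A₃ - B₂) * (u₂ - v₂) * (u₁ - v₂)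
          + (A₅ - B₃) * (u₃ - v₂) * (A₂ - B₂) * (u₁ - v₂)
          + (A₅ - B₃) * (u₃ - v₂) * (u₂ - v₂) * (A₁ - B₂)
          + (u₅ - v₃) * (A₃ - B₂) * (A₂ - B₂) * (u₁ - v₂)
          + (u₅ - v₃) * (A₃ - B₂) * (u₂ - v₂) * (A₁ - B₂)
          + (u₅ - v₃) * (u₃ - v₂) * (A₂ - B₂) * (A₁ - B₂)
          + (A₅ - B₃) * (A₄ - B₃) * (u₂ - v₂) * (u₁ - v₂)
          + (A₅ - B₃) * (u₄ - v₃) * (A₂ - B₂) * (u₁ - v₂)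
          + (A₅ - B₃) * (u₄ - v₃) * (u₂ - v₂) * (A₁ - B₂)
          + (u₅ - v₃) * (A₄ - B₃) * (A₂ - B₂) * (u₁ - v₂)
          + (u₅ - v₃) * (A₄ - B₃) * (u₂ - v₂) * (A₁ - B₂)
          + (u₅ - v₃) * (u₄ - v₃) * (A₂ - B₂) * (A₁ - B₂)
          + (A₅ - B₃) * (A₄ - B₃) * (u₃ - v₃) * (u₁ - v₂)
          + (A₅ - B₃) * (u₄ - v₃) * (A₃ - B₃) * (u₁ - v₂)
          + (A₅ - B₃) * (u₄ - v₃) * (u₃ - v₃) * (A₁ - B₂)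
          + (u₅ - v₃) * (A₄ - B₃) * (A₃ - B₃) * (u₁ - v₂)
          + (u₅ - v₃) * (A₄ - B₃) * (u₃ - v₃) * (A₁ - B₂)
          + (u₅ - v₃) * (u₄ - v₃) * (A₃ - B₃) * (A₁ - B₂)
          + (A₅ - B₃) * (A₄ - B₃) * (u₃ - v₃) * (u₂ - v₃)
          + (A₅ - B₃) * (u₄ - v₃) * (A₃ - B₃) * (u₂ - v₃)
          + (A₅ - B₃) * (u₄ - v₃) * (u₃ - v₃) * (A₂ - B₃)
          + (u₅ - v₃) * (A₄ - B₃) * (A₃ - B₃) * (u₂ - v₃)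
          + (u₅ - v₃) * (A₄ - B₃) * (u₃ - v₃) * (A₂ - B₃)
          + (u₅ - v₃) * (u₄ - v₃) * (A₃ - B₃) * (A₂ - B₃))
        - 6 * l * ((u₄ - v₂) * (u₃ - v₂) * (u₂ - v₂) * (u₁ - v₂)
          + (u₅ - v₃) * (u₃ - v₂) * (u₂ - v₂) * (u₁ - v₂)
          + (u₅ - v₃) * (u₄ - v₃) * (u₂ - v₂) * (u₁ - v₂)
          + (u₅ - v₃) * (u₄ - v₃) * (u₃ - v₃) * (u₁ - v₂)
          + (u₅ - v₃) * (u₄ - v₃) * (u₃ - v₃) * (u₂ - v₃))) := by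
    rw [← key]; ring
  rw [key']
  linarith [t₅, t₄, t₃, t₂, t₁]

end Summit.HodgeConjecture.HodgeConjecture.WeilClassTestFormatFiveThreeLowPair
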